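import Literature.NumberTheory.Sieve.DrappeauTopacogullari
import Literature.NumberTheory.Sieve.MoebiusCoprimeProgressions
import Literature.NumberTheory.LFunctions.SiegelWalfiszMoebiusProofs
import Literature.NumberTheory.Sieve.DivisorPowerSums
import HarnessLib

/-!
# Drappeau–Topacogullari 2019: Theorem 1.3 at `z = −1` from Theorem 1.2 — the main term for `μ`

S. Drappeau, B. Topacogullari, *Combinatorial identities and Titchmarsh's divisor problem for
multiplicative functions*, Algebra & Number Theory 13 (2019) 2383–2425 (`DrappeauTopacogullari2019`,
held: `paper:arxiv-1807.09569`; §1 pp. 3–5, §8 pp. 23–24 read).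

The source proves Theorem 1.3 (the case `f = d_z`) FROM Theorem 1.2 (§8.1, p. 24: "The applications
mentioned in the introduction are essentially all immediate corollaries of Theorem 1.2, except for
the fact that it remains to evaluate the main terms"): for `a = 1` the main term is
`M_{d_z}(x; 1, h) = 2 ∑_{q ≤ √x} φ(q/(h,q))⁻¹ ∑_{q² ≤ n ≤ x, (n,q) = (h,q)} d_z(n)`, evaluated by the
Selberg–Delange method, and "if `z` is a non-positive integer, all the coefficients `λ_{h,ℓ}(z)`
vanish" (p. 5).  At `z = −1`, `d_{−1} = μ`, this vanishing is just the prime number theorem for `μ`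
with a coprimality condition, which the tree has in Siegel–Walfisz strength
(`Literature.NumberTheory.LFunctions.SiegelWalfiszMoebius_holds`,
`Literature.NumberTheory.LFunctions.SiegelWalfiszMoebius.sum_coprime_progression_le`, PROVED).

This file (a theorem-only sibling of `Literature.NumberTheory.Sieve.DrappeauTopacogullari`, next to
`Literature.NumberTheory.Sieve.DrappeauTopacogullariProofs`, which collects the proved bricks of
Theorem 1.2 itself) PROVES that step for the tree forms of the two statements
(`Literature.NumberTheory.Sieve.DrappeauTopacogullari2019.thm12_conductorOne`, Theorem 1.2 at `D = 1`,
an unproved named fact — dispersion method and bounds for sums of Kloosterman sums — and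
`Literature.NumberTheory.Sieve.DrappeauTopacogullari2019.thm13_moebius`, Theorem 1.3 at `z = −1`):

* `DrappeauTopacogullari2019.norm_mainTermOne_moebius_le` — for every `N` there is `C` with
  `‖M_μ(x; h, 1)‖ ≤ C x/(log x)^N` for `x ≥ 2`, `1 ≤ |h| ≤ x^{1/2}` (`mainTermOne` with `f = μ`, `a = 1`).
  Proof: in the inner sum `(n, q) = g := (|h|, q)` forces `n = g m` with
  `μ(g m) 1_{(m, q/g) = 1} = μ(g) μ(m) 1_{(m, q) = 1}`, so the inner sum is at most two sums
  `|∑_{m ≤ Z, (m,q)=1} μ(m)| ≪_B 4^{ω(q)} (x/g) (log x)^{−B}` (`Z ≤ x/g`, `x/g ≥ √x`); with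
  `φ(q/g)⁻¹ ≤ τ(q) g/q` and `4^{ω(q)} ≤ τ(q)²` the `q`-sum is `≪ x (log x)^{−B} ∑_{q ≤ √x} τ(q)³/q
  ≪ x (log x)^{16−B}`.
* `DrappeauTopacogullari2019.thm12_conductorOne.thm13_moebius` — **Theorem 1.2 (`D = 1`) implies
  Theorem 1.3 at `z = −1`** in their tree forms: apply Theorem 1.2 with `A = 1`, `f = μ ∈ 𝓕₁(1)`
  (`moebius_mem_classF`), `a = 1` and the shift `−h` (so that `τ(an − (−h)) = τ(n + h)` and
  `τ((a, h)) = 1`), and subtract the main term.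

No new definitions and no new named facts (D-0026): once `thm12_conductorOne` is discharged,
`thm13_moebius_holds` is `thm12_conductorOne_holds.thm13_moebius`.

## References

* S. Drappeau, B. Topacogullari, *Combinatorial identities and Titchmarsh's divisor problem for
  multiplicative functions*, Algebra Number Theory 13 (2019), no. 10, 2383–2425,
  doi:10.2140/ant.2019.13.2383, arXiv:1807.09569: Theorem 1.2 (p. 4), Theorem 1.3 and the remark on
  non-positive integers `z` (pp. 4–5), §8.1 (p. 24). [DrappeauTopacogullari2019]
* H. L. Montgomery, R. C. Vaughan, *Multiplicative Number Theory I*, CUP 2007, §11.3 Exercise 13(f)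
  (Siegel–Walfisz for `μ`). [MontgomeryVaughan2007]
-/

noncomputable section

open scoped ArithmeticFunction.sigma ArithmeticFunction.Moebius ArithmeticFunction.omega
open ArithmeticFunction Finset Real

namespace Literature.NumberTheory.Sieve

namespace DrappeauTopacogullari2019

/-! ### Möbius sums with a coprimality condition -/

/-- Trivial bound: `|∑_{m ≤ Z, P(m)} μ(m)| ≤ Z`. [folklore] -/
theorem abs_sum_filter_moebius_le (Z : ℕ) (P : ℕ → Prop) [DecidablePred P] :
    |∑ m ∈ (Icc 1 Z).filter P, (μ m : ℝ)| ≤ Z := by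
  calc |∑ m ∈ (Icc 1 Z).filter P, (μ m : ℝ)| ≤ ∑ m ∈ (Icc 1 Z).filter P, |(μ m : ℝ)| :=
        Finset.abs_sum_le_sum_abs _ _
    _ ≤ ∑ m ∈ (Icc 1 Z).filter P, (1 : ℝ) :=
        Finset.sum_le_sum fun m _ => by exact_mod_cast ArithmeticFunction.abs_moebius_le_one
    _ ≤ ∑ m ∈ Icc 1 Z, (1 : ℝ) :=
        Finset.sum_le_sum_of_subset_of_nonneg (Finset.filter_subset _ _) fun _ _ _ => zero_le_one
    _ = Z := by simp

/-- **`∑_{m ≤ Z, (m,q)=1} μ(m) ≪_B 4^{ω(q)} Z (log Z)^{−B}`** for `Z ≥ 2`, `q ≥ 1`: the case `k = 1` of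
`Literature.NumberTheory.LFunctions.SiegelWalfiszMoebius.sum_coprime_progression_le` fed with the
PROVED Siegel–Walfisz theorem for `μ` (`Literature.NumberTheory.LFunctions.SiegelWalfiszMoebius_holds`);
`Z = 2` by the trivial bound. [cite: MontgomeryVaughan2007, §11.3 Exercise 13(f)] -/
theorem abs_sum_moebius_coprime_le {B : ℝ} (hB : 0 ≤ B) :
    ∃ C : ℝ, 0 ≤ C ∧ ∀ Z : ℕ, 2 ≤ Z → ∀ q : ℕ, q ≠ 0 →
      |∑ m ∈ (Icc 1 Z).filter (fun m : ℕ => m.Coprime q), (μ m : ℝ)| ≤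
        C * (4 : ℝ) ^ q.primeFactors.card * Z / Real.log Z ^ B := by
  obtain ⟨C, hC0, hC⟩ :=
    LFunctions.SiegelWalfiszMoebius_holds.sum_coprime_progression_le (A := 1) one_pos hB
  refine ⟨max C 1, le_max_of_le_left hC0, fun Z hZ q hq => ?_⟩
  have hω : (1 : ℝ) ≤ (4 : ℝ) ^ q.primeFactors.card := one_le_pow₀ (by norm_num)
  have hZ2 : (2 : ℝ) ≤ Z := by exact_mod_cast hZ
  have hlog0 : 0 < Real.log Z := Real.log_pos (by linarith)
  rcases eq_or_lt_of_le hZ with hZ2' | hZ3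
  · -- `Z = 2`: trivial bound `≤ 2`, and `(log 2)^B ≤ 1`
    subst hZ2'
    have hlog1 : Real.log (2 : ℕ) ^ B ≤ 1 := by
      refine Real.rpow_le_one hlog0.le ?_ hB
      have := Real.log_two_lt_d9
      push_cast; linarith
    calc |∑ m ∈ (Icc 1 2).filter (fun m : ℕ => m.Coprime q), (μ m : ℝ)| ≤ (2 : ℕ) :=
          abs_sum_filter_moebius_le 2 _
      _ ≤ max C 1 * (4 : ℝ) ^ q.primeFactors.card * (2 : ℕ) := by
          have h1 : (1 : ℝ) ≤ max C 1 * (4 : ℝ) ^ q.primeFactors.card :=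
            one_le_mul_of_one_le_of_one_le (le_max_right _ _) hω
          have h2 : (0 : ℝ) ≤ ((2 : ℕ) : ℝ) := by positivity
          nlinarith
      _ ≤ max C 1 * (4 : ℝ) ^ q.primeFactors.card * (2 : ℕ) / Real.log (2 : ℕ) ^ B := by
          rw [le_div_iff₀ (Real.rpow_pos_of_pos hlog0 B)]
          have h0 : 0 ≤ max C 1 * (4 : ℝ) ^ q.primeFactors.card * (2 : ℕ) := by positivity
          nlinarith
  · -- `Z ≥ 3`: Siegel–Walfisz with `k = 1`
    have hZ3' : (3 : ℝ) ≤ Z := by exact_mod_cast hZ3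
    have hlogZ : (1 : ℝ) ≤ Real.log Z := by
      rw [← Real.log_exp 1]
      exact Real.log_le_log (Real.exp_pos 1) (le_trans Real.exp_one_lt_three.le hZ3')
    have hk : ((1 : ℕ) : ℝ) ≤ Real.log (Z : ℝ) ^ (1 : ℝ) := by
      rw [Real.rpow_one]; exact_mod_cast hlogZ
    have h := hC Z hZ2 1 le_rfl hk 0 (isUnit_of_subsingleton _) q hq
    rw [Nat.floor_natCast] at h
    have hfilter : (Icc 1 Z).filter (fun n : ℕ => ((n : ZMod 1) = 0 ∧ n.Coprime q)) =
        (Icc 1 Z).filter (fun m : ℕ => m.Coprime q) :=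
      Finset.filter_congr fun n _ => by simp [Subsingleton.elim (n : ZMod 1) 0]
    rw [hfilter] at h
    refine h.trans ?_
    have : 0 ≤ (4 : ℝ) ^ q.primeFactors.card * Z / Real.log Z ^ B := by positivity
    calc C * (4 : ℝ) ^ q.primeFactors.card * Z / Real.log Z ^ B
        = C * ((4 : ℝ) ^ q.primeFactors.card * Z / Real.log Z ^ B) := by ring
      _ ≤ max C 1 * ((4 : ℝ) ^ q.primeFactors.card * Z / Real.log Z ^ B) :=
          mul_le_mul_of_nonneg_right (le_max_left _ _) this
      _ = max C 1 * (4 : ℝ) ^ q.primeFactors.card * Z / Real.log Z ^ B := by ring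

/-- Uniform version: for `B ≥ 0` there is `C` with
`|∑_{m ≤ Z, (m,q)=1} μ(m)| ≤ C 4^{ω(q)} y (log y)^{−B}` for all real `y ≥ 2`, all `Z ≤ y` and `q ≥ 1`
(trivial bound for `Z ≤ y^{3/4}`, the previous lemma with `log Z ≥ (3/4) log y` beyond). [folklore] -/
theorem abs_sum_moebius_coprime_le_of_le {B : ℝ} (hB : 0 ≤ B) :
    ∃ C : ℝ, 0 ≤ C ∧ ∀ y : ℝ, 2 ≤ y → ∀ Z : ℕ, (Z : ℝ) ≤ y → ∀ q : ℕ, q ≠ 0 →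
      |∑ m ∈ (Icc 1 Z).filter (fun m : ℕ => m.Coprime q), (μ m : ℝ)| ≤
        C * (4 : ℝ) ^ q.primeFactors.card * y / Real.log y ^ B := by
  obtain ⟨C₁, hC₁0, hC₁⟩ := abs_sum_moebius_coprime_le hB
  obtain ⟨C₂, hC₂0, hC₂⟩ := exists_rpow_three_quarters_le hB
  refine ⟨C₂ + C₁ * (4 / 3 : ℝ) ^ B, by positivity, fun y hy Z hZy q hq => ?_⟩
  have hy0 : 0 < y := by linarith
  have hlogy : 0 < Real.log y := Real.log_pos (by linarith)
  have hω : (1 : ℝ) ≤ (4 : ℝ) ^ q.primeFactors.card := one_le_pow₀ (by norm_num)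
  have hden : 0 < Real.log y ^ B := Real.rpow_pos_of_pos hlogy B
  set S := ∑ m ∈ (Icc 1 Z).filter (fun m : ℕ => m.Coprime q), (μ m : ℝ) with hS
  by_cases hsmall : (Z : ℝ) ≤ y ^ (3 / 4 : ℝ)
  · -- trivial bound
    calc |S| ≤ Z := abs_sum_filter_moebius_le Z _
      _ ≤ y ^ (3 / 4 : ℝ) := hsmall
      _ ≤ C₂ * y / Real.log y ^ B := hC₂ y hy
      _ ≤ C₂ * (4 : ℝ) ^ q.primeFactors.card * y / Real.log y ^ B := by
          rw [div_le_div_iff_of_pos_right hden]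
          have : 0 ≤ C₂ * y := by positivity
          calc C₂ * y = C₂ * y * 1 := (mul_one _).symm
            _ ≤ C₂ * y * (4 : ℝ) ^ q.primeFactors.card := mul_le_mul_of_nonneg_left hω this
            _ = C₂ * (4 : ℝ) ^ q.primeFactors.card * y := by ring
      _ ≤ (C₂ + C₁ * (4 / 3 : ℝ) ^ B) * (4 : ℝ) ^ q.primeFactors.card * y / Real.log y ^ B := by
          rw [div_le_div_iff_of_pos_right hden]
          have : 0 ≤ (4 : ℝ) ^ q.primeFactors.card * y := by positivity
          have h' : C₂ ≤ C₂ + C₁ * (4 / 3 : ℝ) ^ B := le_add_of_nonneg_right (by positivity)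
          calc C₂ * (4 : ℝ) ^ q.primeFactors.card * y = C₂ * ((4 : ℝ) ^ q.primeFactors.card * y) := by
                ring
            _ ≤ (C₂ + C₁ * (4 / 3 : ℝ) ^ B) * ((4 : ℝ) ^ q.primeFactors.card * y) :=
                mul_le_mul_of_nonneg_right h' this
            _ = _ := by ring
  · rw [not_le] at hsmall
    have hy1 : (1 : ℝ) ≤ y ^ (3 / 4 : ℝ) := Real.one_le_rpow (by linarith) (by norm_num)
    have hZ1 : (1 : ℝ) < Z := lt_of_le_of_lt hy1 hsmall
    have hZ2 : 2 ≤ Z := by exact_mod_cast hZ1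
    have hZ0 : (0 : ℝ) < Z := by linarith
    have hlogZ : 3 / 4 * Real.log y ≤ Real.log Z := by
      rw [← Real.log_rpow hy0]
      exact Real.log_le_log (Real.rpow_pos_of_pos hy0 _) hsmall.le
    have hlogZ0 : 0 < Real.log Z := lt_of_lt_of_le (by positivity) hlogZ
    have h := hC₁ Z hZ2 q hq
    refine h.trans ?_
    -- `Z/(log Z)^B ≤ (4/3)^B y/(log y)^B`
    have hpow : (3 / 4 * Real.log y) ^ B ≤ Real.log Z ^ B :=
      Real.rpow_le_rpow (by positivity) hlogZ hB
    have hpow' : (3 / 4 * Real.log y) ^ B = (3 / 4 : ℝ) ^ B * Real.log y ^ B :=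
      Real.mul_rpow (by norm_num) hlogy.le
    have h43 : (4 / 3 : ℝ) ^ B * (3 / 4 : ℝ) ^ B = 1 := by
      rw [← Real.mul_rpow (by norm_num) (by norm_num)]; norm_num
    have hdenZ : 0 < Real.log Z ^ B := Real.rpow_pos_of_pos hlogZ0 B
    rw [div_le_div_iff₀ hdenZ hden]
    calc C₁ * (4 : ℝ) ^ q.primeFactors.card * Z * Real.log y ^ B
        ≤ C₁ * (4 : ℝ) ^ q.primeFactors.card * y * Real.log y ^ B := by gcongr
      _ = C₁ * (4 / 3 : ℝ) ^ B * (4 : ℝ) ^ q.primeFactors.card * y *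
            ((3 / 4 : ℝ) ^ B * Real.log y ^ B) := by
          calc C₁ * (4 : ℝ) ^ q.primeFactors.card * y * Real.log y ^ B
              = C₁ * (4 : ℝ) ^ q.primeFactors.card * y * Real.log y ^ B *
                  ((4 / 3 : ℝ) ^ B * (3 / 4 : ℝ) ^ B) := by rw [h43, mul_one]
            _ = _ := by ring
      _ ≤ C₁ * (4 / 3 : ℝ) ^ B * (4 : ℝ) ^ q.primeFactors.card * y * Real.log Z ^ B := by
          rw [← hpow']
          exact mul_le_mul_of_nonneg_left hpow (by positivity)
      _ ≤ (C₂ + C₁ * (4 / 3 : ℝ) ^ B) * (4 : ℝ) ^ q.primeFactors.card * y * Real.log Z ^ B := by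
          have : 0 ≤ (4 : ℝ) ^ q.primeFactors.card * y * Real.log Z ^ B := by positivity
          have h' : C₁ * (4 / 3 : ℝ) ^ B ≤ C₂ + C₁ * (4 / 3 : ℝ) ^ B := le_add_of_nonneg_left hC₂0
          calc C₁ * (4 / 3 : ℝ) ^ B * (4 : ℝ) ^ q.primeFactors.card * y * Real.log Z ^ B
              = C₁ * (4 / 3 : ℝ) ^ B * ((4 : ℝ) ^ q.primeFactors.card * y * Real.log Z ^ B) := by ring
            _ ≤ (C₂ + C₁ * (4 / 3 : ℝ) ^ B) * ((4 : ℝ) ^ q.primeFactors.card * y * Real.log Z ^ B) :=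
                mul_le_mul_of_nonneg_right h' this
            _ = _ := by ring

/-! ### The inner sum of the main term: from `(n, q) = g` to `(m, q) = 1` -/

/-- Reindexing `n = g m` in the inner sum of `M_f(x; h, 1)`: for `g ≥ 1`,
`∑_{n ≤ X, q² ≤ n, (n,q) = g} F(n) = ∑_{m ≤ X/g, q² ≤ g m, (g m, q) = g} F(g m)`. [folklore] -/
theorem sum_filter_gcd_eq_sum_mul (q g X : ℕ) (hg0 : g ≠ 0) (F : ℕ → ℝ) :
    ∑ n ∈ (Icc 1 X).filter (fun n : ℕ => q ^ 2 ≤ n ∧ Nat.gcd n q = g), F n =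
      ∑ m ∈ (Icc 1 (X / g)).filter (fun m : ℕ => q ^ 2 ≤ g * m ∧ Nat.gcd (g * m) q = g),
        F (g * m) := by
  have hgpos : 0 < g := Nat.pos_of_ne_zero hg0
  refine Finset.sum_nbij' (fun n => n / g) (fun m => g * m) ?_ ?_ ?_ ?_ ?_
  · intro n hn
    simp only [Finset.mem_filter, Finset.mem_Icc] at hn ⊢
    obtain ⟨⟨hn1, hnX⟩, hq2, hgcd⟩ := hn
    have hgn : g ∣ n := hgcd ▸ Nat.gcd_dvd_left n q
    have hngn : g * (n / g) = n := Nat.mul_div_cancel' hgn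
    refine ⟨⟨Nat.div_pos (Nat.le_of_dvd hn1 hgn) hgpos, Nat.div_le_div_right hnX⟩, ?_, ?_⟩
    · rwa [hngn]
    · rwa [hngn]
  · intro m hm
    simp only [Finset.mem_filter, Finset.mem_Icc] at hm ⊢
    obtain ⟨⟨hm1, hmX⟩, hq2, hgcd⟩ := hm
    refine ⟨⟨Nat.one_le_iff_ne_zero.2 (mul_ne_zero hg0 (by omega)), ?_⟩, hq2, hgcd⟩
    have := (Nat.le_div_iff_mul_le hgpos).1 hmX
    rwa [mul_comm] at this
  · intro n hn
    simp only [Finset.mem_filter, Finset.mem_Icc] at hn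
    have hgn : g ∣ n := hn.2.2 ▸ Nat.gcd_dvd_left n q
    exact Nat.mul_div_cancel' hgn
  · intro m _
    exact Nat.mul_div_cancel_left m hgpos
  · intro n hn
    simp only [Finset.mem_filter, Finset.mem_Icc] at hn
    have hgn : g ∣ n := hn.2.2 ▸ Nat.gcd_dvd_left n q
    rw [Nat.mul_div_cancel' hgn]

/-- The summand identity: for `g ∣ q`, `q ≥ 1`,
`1_{(g m, q) = g} μ(g m) = 1_{(m, q) = 1} μ(g) μ(m)` (if `(m, q) = 1` then `(g, m) = 1` and
`(g m, q) = g (m, q/g) = g`; if a prime `p` divides `(m, q)` and `(g m, q) = g` then `p ∣ g`, so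
`p² ∣ g m` and `μ(g m) = 0`). [folklore] -/
theorem ite_gcd_mul_moebius_eq (q g m : ℕ) (hq : q ≠ 0) (hg : g ∣ q) :
    (if Nat.gcd (g * m) q = g then (μ (g * m) : ℝ) else 0) =
      if m.Coprime q then (μ g : ℝ) * μ m else 0 := by
  obtain ⟨q', rfl⟩ := hg
  have hg0 : g ≠ 0 := fun h => hq (by rw [h, zero_mul])
  by_cases hcop : m.Coprime (g * q')
  · have hmq' : Nat.gcd m q' = 1 := Nat.Coprime.coprime_dvd_right (dvd_mul_left q' g) hcop
    have h1 : Nat.gcd (g * m) (g * q') = g := by rw [Nat.gcd_mul_left, hmq', mul_one]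
    have h2 : g.Coprime m := Nat.Coprime.coprime_dvd_left (dvd_mul_right g q') hcop.symm
    rw [if_pos h1, if_pos hcop, ArithmeticFunction.isMultiplicative_moebius.map_mul_of_coprime h2]
    push_cast; ring
  · rw [if_neg hcop]
    split_ifs with h1
    · obtain ⟨p, hp, hpm, hpq⟩ := Nat.Prime.not_coprime_iff_dvd.1 hcop
      have hpg : p ∣ g := by
        have : p ∣ Nat.gcd (g * m) (g * q') := Nat.dvd_gcd (dvd_mul_of_dvd_right hpm g) hpq
        rwa [h1] at this
      have hsq : ¬Squarefree (g * m) := fun hsf =>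
        hp.not_isUnit (hsf p (mul_dvd_mul hpg hpm))
      rw [ArithmeticFunction.moebius_eq_zero_of_not_squarefree hsq]; push_cast; rfl
    · rfl

/-- **The inner sum of `M_μ(x; h, 1)`**: for `q ≥ 1` and `g ∣ q`,
`∑_{n ≤ X, q² ≤ n, (n,q) = g} μ(n) = μ(g) ∑_{m ≤ X/g, q² ≤ g m, (m,q) = 1} μ(m)`. [folklore] -/
theorem sum_moebius_gcd_eq (q g X : ℕ) (hq : q ≠ 0) (hg : g ∣ q) :
    ∑ n ∈ (Icc 1 X).filter (fun n : ℕ => q ^ 2 ≤ n ∧ Nat.gcd n q = g), (μ n : ℝ) =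
      (μ g : ℝ) * ∑ m ∈ (Icc 1 (X / g)).filter (fun m : ℕ => q ^ 2 ≤ g * m ∧ m.Coprime q),
        (μ m : ℝ) := by
  have hg0 : g ≠ 0 := fun h => hq (Nat.eq_zero_of_zero_dvd (h ▸ hg))
  rw [sum_filter_gcd_eq_sum_mul q g X hg0 (fun n => (μ n : ℝ)), Finset.sum_filter, Finset.sum_filter,
    Finset.mul_sum]
  refine Finset.sum_congr rfl fun m _ => ?_
  by_cases hA : q ^ 2 ≤ g * m
  · simp only [hA, true_and]
    rw [ite_gcd_mul_moebius_eq q g m hq hg]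
    split_ifs <;> simp
  · simp [hA]

/-- **Bound for the inner sum**: for `q ≥ 1`, `g ∣ q`, there is `Y' ≤ X/g` with
`|∑_{n ≤ X, q² ≤ n, (n,q) = g} μ(n)| ≤ |∑_{m ≤ X/g, (m,q)=1} μ(m)| + |∑_{m ≤ Y', (m,q)=1} μ(m)|`
(the range `q² ≤ g m` is `m > Y'` with `Y' = min(X/g, (q² − 1)/g)`). [folklore] -/
theorem abs_sum_moebius_gcd_le (q g X : ℕ) (hq : q ≠ 0) (hg : g ∣ q) :
    ∃ Y' : ℕ, Y' ≤ X / g ∧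
      |∑ n ∈ (Icc 1 X).filter (fun n : ℕ => q ^ 2 ≤ n ∧ Nat.gcd n q = g), (μ n : ℝ)| ≤
        |∑ m ∈ (Icc 1 (X / g)).filter (fun m : ℕ => m.Coprime q), (μ m : ℝ)| +
          |∑ m ∈ (Icc 1 Y').filter (fun m : ℕ => m.Coprime q), (μ m : ℝ)| := by
  have hg0 : g ≠ 0 := fun h => hq (Nat.eq_zero_of_zero_dvd (h ▸ hg))
  have hgpos : 0 < g := Nat.pos_of_ne_zero hg0
  set Y := X / g with hY
  set Y' := min Y ((q ^ 2 - 1) / g) with hY'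
  refine ⟨Y', min_le_left _ _, ?_⟩
  rw [sum_moebius_gcd_eq q g X hq hg]
  -- split the coprime sum over `m ≤ Y` at `q² ≤ g m`
  have hsplit := Finset.sum_filter_add_sum_filter_not ((Icc 1 Y).filter (fun m : ℕ => m.Coprime q))
    (fun m : ℕ => q ^ 2 ≤ g * m) (fun m : ℕ => (μ m : ℝ))
  rw [Finset.filter_filter, Finset.filter_filter] at hsplit
  have hA : (Icc 1 Y).filter (fun m : ℕ => m.Coprime q ∧ q ^ 2 ≤ g * m) =
      (Icc 1 Y).filter (fun m : ℕ => q ^ 2 ≤ g * m ∧ m.Coprime q) :=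
    Finset.filter_congr fun m _ => and_comm
  have hB : (Icc 1 Y).filter (fun m : ℕ => m.Coprime q ∧ ¬q ^ 2 ≤ g * m) =
      (Icc 1 Y').filter (fun m : ℕ => m.Coprime q) := by
    ext m
    simp only [Finset.mem_filter, Finset.mem_Icc, hY', le_min_iff, not_le]
    have hq1 : 1 ≤ q ^ 2 := Nat.one_le_iff_ne_zero.2 (pow_ne_zero 2 hq)
    constructor
    · rintro ⟨⟨hm1, hmY⟩, hcop, hlt⟩
      refine ⟨⟨hm1, hmY, ?_⟩, hcop⟩
      rw [Nat.le_div_iff_mul_le hgpos]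
      rw [mul_comm] at hlt
      omega
    · rintro ⟨⟨hm1, hmY, hm'⟩, hcop⟩
      refine ⟨⟨hm1, hmY⟩, hcop, ?_⟩
      rw [Nat.le_div_iff_mul_le hgpos] at hm'
      rw [mul_comm]
      omega
  rw [hA, hB] at hsplit
  -- `∑_{q² ≤ gm} = ∑_{all} − ∑_{m ≤ Y'}`
  have heq : ∑ m ∈ (Icc 1 Y).filter (fun m : ℕ => q ^ 2 ≤ g * m ∧ m.Coprime q), (μ m : ℝ) =
      ∑ m ∈ (Icc 1 Y).filter (fun m : ℕ => m.Coprime q), (μ m : ℝ) -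
        ∑ m ∈ (Icc 1 Y').filter (fun m : ℕ => m.Coprime q), (μ m : ℝ) := by linarith
  rw [heq, abs_mul]
  have hμg : |(μ g : ℝ)| ≤ 1 := by exact_mod_cast ArithmeticFunction.abs_moebius_le_one
  calc |(μ g : ℝ)| * |∑ m ∈ (Icc 1 Y).filter (fun m : ℕ => m.Coprime q), (μ m : ℝ) -
          ∑ m ∈ (Icc 1 Y').filter (fun m : ℕ => m.Coprime q), (μ m : ℝ)|
      ≤ 1 * |∑ m ∈ (Icc 1 Y).filter (fun m : ℕ => m.Coprime q), (μ m : ℝ) -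
          ∑ m ∈ (Icc 1 Y').filter (fun m : ℕ => m.Coprime q), (μ m : ℝ)| :=
        mul_le_mul_of_nonneg_right hμg (abs_nonneg _)
    _ ≤ _ := by rw [one_mul]; exact abs_sub _ _


/-! ### The main term `M_μ(x; h, 1)` -/

/-- `mainTermOne` at `a = 1`, with the real condition `q²/1 ≤ n` read in `ℕ`. [folklore] -/
theorem mainTermOne_one (f : ArithmeticFunction ℂ) (x : ℝ) (h : ℤ) :
    mainTermOne f x h 1 = 2 * ∑ q ∈ Icc 1 ⌊Real.sqrt x⌋₊,
      ((Nat.totient (q / Nat.gcd h.natAbs q) : ℂ)⁻¹ *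
        ∑ n ∈ (Icc 1 ⌊x⌋₊).filter (fun n : ℕ => q ^ 2 ≤ n ∧ Nat.gcd n q = Nat.gcd h.natAbs q),
          f n) := by
  unfold mainTermOne
  simp only [Nat.cast_one, one_mul, div_one]
  congr 1
  refine Finset.sum_congr rfl fun q _ => ?_
  congr 1
  refine Finset.sum_congr (Finset.filter_congr fun n _ => ?_) fun _ _ => rfl
  exact ⟨fun ⟨h1, h2⟩ => ⟨by exact_mod_cast h1, h2⟩, fun ⟨h1, h2⟩ => ⟨by exact_mod_cast h1, h2⟩⟩

/-- The inner sum of `M_μ` is real: `∑ μ(n)` over `ℂ` is the cast of the real sum. [folklore] -/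
theorem sum_moebius_complex_eq (s : Finset ℕ) :
    ∑ n ∈ s, ((μ : ArithmeticFunction ℤ) : ArithmeticFunction ℂ) n =
      ((∑ n ∈ s, (μ n : ℝ) : ℝ) : ℂ) := by
  rw [Complex.ofReal_sum]
  refine Finset.sum_congr rfl fun n _ => ?_
  rw [ArithmeticFunction.intCoe_apply]; push_cast; rfl

/-- **The `q`-th term of `M_μ(x; h, 1)`**: given the uniform bound
`|∑_{m ≤ Z, (m,q)=1} μ(m)| ≤ C₁ 4^{ω(q)} y (log y)^{−B}` (`Z ≤ y`, `y ≥ 2`), for `x ≥ 2`,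
`1 ≤ H ≤ x^{1/2}` and `q ≥ 1`, with `g = (H, q)`:
`φ(q/g)⁻¹ |∑_{n ≤ x, q² ≤ n, (n,q) = g} μ(n)| ≤ 2 C₁ 2^B τ(q)³/q · x/(log x)^B`
(inner sum `≤ 2 C₁ 4^{ω(q)} (x/g) 2^B (log x)^{−B}` as `x/g ≥ x^{1/2}`, `φ(q/g)⁻¹ ≤ τ(q) g/q`,
`4^{ω(q)} ≤ τ(q)²`). [folklore] -/
theorem totient_inv_mul_abs_inner_le {B C₁ : ℝ} (hB : 0 ≤ B) (hC₁ : 0 ≤ C₁)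
    (hM : ∀ y : ℝ, 2 ≤ y → ∀ Z : ℕ, (Z : ℝ) ≤ y → ∀ q : ℕ, q ≠ 0 →
      |∑ m ∈ (Icc 1 Z).filter (fun m : ℕ => m.Coprime q), (μ m : ℝ)| ≤
        C₁ * (4 : ℝ) ^ q.primeFactors.card * y / Real.log y ^ B)
    {x : ℝ} (hx : 2 ≤ x) {H : ℕ} (hH : 1 ≤ H) (hHx : (H : ℝ) ≤ x ^ (1 / 2 : ℝ)) {q : ℕ} (hq : 1 ≤ q) :
    ((Nat.totient (q / Nat.gcd H q) : ℝ))⁻¹ *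
        |∑ n ∈ (Icc 1 ⌊x⌋₊).filter (fun n : ℕ => q ^ 2 ≤ n ∧ Nat.gcd n q = Nat.gcd H q), (μ n : ℝ)| ≤
      2 * C₁ * (2 : ℝ) ^ B * ((σ 0 q : ℝ) ^ 3 / q) * (x / Real.log x ^ B) := by
  have hx0 : 0 < x := by linarith
  have hlogx : 0 < Real.log x := Real.log_pos (by linarith)
  have hq0 : q ≠ 0 := Nat.one_le_iff_ne_zero.1 hq
  have hqpos : (0 : ℝ) < q := by exact_mod_cast hq
  set g := Nat.gcd H q with hgdef
  have hgq : g ∣ q := Nat.gcd_dvd_right H q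
  have hgpos : 0 < g := Nat.gcd_pos_of_pos_right H hq
  have hg0 : g ≠ 0 := hgpos.ne'
  have hgH : g ≤ H := Nat.gcd_le_left q hH
  have hgR : (0 : ℝ) < g := by exact_mod_cast hgpos
  have hg1 : (1 : ℝ) ≤ g := by exact_mod_cast hgpos
  have hgx : (g : ℝ) ≤ x ^ (1 / 2 : ℝ) := le_trans (by exact_mod_cast hgH) hHx
  have hsqrt : x ^ (1 / 2 : ℝ) * x ^ (1 / 2 : ℝ) = x := by
    rw [← Real.rpow_add hx0]; norm_num
  have hsqrt_pos : 0 < x ^ (1 / 2 : ℝ) := Real.rpow_pos_of_pos hx0 _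
  -- `y = x / g ≥ x^{1/2}` and `y ≥ 2`
  set y : ℝ := x / g with hydef
  have hyx : x ^ (1 / 2 : ℝ) ≤ y := by
    rw [hydef, le_div_iff₀ hgR]
    calc x ^ (1 / 2 : ℝ) * g ≤ x ^ (1 / 2 : ℝ) * x ^ (1 / 2 : ℝ) :=
          mul_le_mul_of_nonneg_left hgx hsqrt_pos.le
      _ = x := hsqrt
  have hy2 : 2 ≤ y := by
    rcases eq_or_lt_of_le (Nat.one_le_iff_ne_zero.2 hg0) with h1 | h2
    · -- `g = 1`
      rw [hydef, ← h1]; simpa using hx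
    · -- `g ≥ 2`: `y ≥ g ≥ 2` since `g² ≤ x`
      have hg2 : (2 : ℝ) ≤ g := by exact_mod_cast h2
      have hgg : (g : ℝ) * g ≤ x := by
        calc (g : ℝ) * g ≤ x ^ (1 / 2 : ℝ) * x ^ (1 / 2 : ℝ) :=
              mul_le_mul hgx hgx hgR.le hsqrt_pos.le
          _ = x := hsqrt
      rw [hydef, le_div_iff₀ hgR]
      nlinarith
  have hy0 : 0 < y := by linarith
  have hlogy : Real.log x ≤ 2 * Real.log y := by
    have h1 : Real.log (x ^ (1 / 2 : ℝ)) ≤ Real.log y := Real.log_le_log hsqrt_pos hyx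
    rw [Real.log_rpow hx0] at h1
    linarith
  have hlogy0 : 0 < Real.log y := by linarith
  -- the inner sum
  obtain ⟨Y', hY', hinner⟩ := abs_sum_moebius_gcd_le q g ⌊x⌋₊ hq0 hgq
  have hZ1 : ((⌊x⌋₊ / g : ℕ) : ℝ) ≤ y := by
    calc ((⌊x⌋₊ / g : ℕ) : ℝ) ≤ (⌊x⌋₊ : ℝ) / g := Nat.cast_div_le
      _ ≤ x / g := div_le_div_of_nonneg_right (Nat.floor_le hx0.le) hgR.le
  have hZ2 : (Y' : ℝ) ≤ y := le_trans (by exact_mod_cast hY') hZ1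
  have hM1 := hM y hy2 (⌊x⌋₊ / g) hZ1 q hq0
  have hM2 := hM y hy2 Y' hZ2 q hq0
  set W : ℝ := (4 : ℝ) ^ q.primeFactors.card with hW
  have hW1 : 1 ≤ W := one_le_pow₀ (by norm_num)
  have hWτ : W ≤ (σ 0 q : ℝ) ^ 2 := four_pow_card_primeFactors_le_sigma_zero_sq hq0
  -- `y/(log y)^B ≤ 2^B (x/g)/(log x)^B`
  have hylog : y / Real.log y ^ B ≤ (2 : ℝ) ^ B * (x / g) / Real.log x ^ B := by
    have hden1 : 0 < Real.log y ^ B := Real.rpow_pos_of_pos hlogy0 B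
    have hden2 : 0 < Real.log x ^ B := Real.rpow_pos_of_pos hlogx B
    rw [div_le_div_iff₀ hden1 hden2]
    have hpow : Real.log x ^ B ≤ (2 * Real.log y) ^ B := Real.rpow_le_rpow hlogx.le hlogy hB
    rw [Real.mul_rpow (by norm_num) hlogy0.le] at hpow
    calc y * Real.log x ^ B ≤ y * ((2 : ℝ) ^ B * Real.log y ^ B) :=
          mul_le_mul_of_nonneg_left hpow hy0.le
      _ = (2 : ℝ) ^ B * (x / g) * Real.log y ^ B := by rw [hydef]; ring
  have hinner' : |∑ n ∈ (Icc 1 ⌊x⌋₊).filter (fun n : ℕ => q ^ 2 ≤ n ∧ Nat.gcd n q = g), (μ n : ℝ)|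
      ≤ 2 * C₁ * (2 : ℝ) ^ B * (σ 0 q : ℝ) ^ 2 * (x / g) / Real.log x ^ B := by
    calc _ ≤ C₁ * W * y / Real.log y ^ B + C₁ * W * y / Real.log y ^ B := hinner.trans (add_le_add hM1 hM2)
      _ = 2 * C₁ * W * (y / Real.log y ^ B) := by ring
      _ ≤ 2 * C₁ * (σ 0 q : ℝ) ^ 2 * ((2 : ℝ) ^ B * (x / g) / Real.log x ^ B) := by
          have h0 : 0 ≤ y / Real.log y ^ B := by positivity
          exact mul_le_mul (by nlinarith) hylog h0 (by positivity)
      _ = 2 * C₁ * (2 : ℝ) ^ B * (σ 0 q : ℝ) ^ 2 * (x / g) / Real.log x ^ B := by ring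
  -- `φ(q/g)⁻¹ ≤ τ(q) g / q`
  have hφ : ((Nat.totient (q / g) : ℝ))⁻¹ ≤ (σ 0 q : ℝ) * g / q := by
    have h1 := inv_totient_le_sigma_zero_div (q / g)
    have hcast : ((q / g : ℕ) : ℝ) = (q : ℝ) / g := Nat.cast_div hgq hgR.ne'
    rw [hcast] at h1
    have hτ : (σ 0 (q / g) : ℝ) ≤ σ 0 q := by
      exact_mod_cast sigma_zero_le_of_dvd hq0 (Nat.div_dvd_of_dvd hgq)
    calc ((Nat.totient (q / g) : ℝ))⁻¹ ≤ (σ 0 (q / g) : ℝ) / ((q : ℝ) / g) := h1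
      _ = (σ 0 (q / g) : ℝ) * g / q := by field_simp
      _ ≤ (σ 0 q : ℝ) * g / q := by gcongr
  have hφ0 : 0 ≤ ((Nat.totient (q / g) : ℝ))⁻¹ := by positivity
  calc ((Nat.totient (q / g) : ℝ))⁻¹ *
        |∑ n ∈ (Icc 1 ⌊x⌋₊).filter (fun n : ℕ => q ^ 2 ≤ n ∧ Nat.gcd n q = g), (μ n : ℝ)|
      ≤ ((σ 0 q : ℝ) * g / q) * (2 * C₁ * (2 : ℝ) ^ B * (σ 0 q : ℝ) ^ 2 * (x / g) / Real.log x ^ B) :=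
        mul_le_mul hφ hinner' (abs_nonneg _) (by positivity)
    _ = 2 * C₁ * (2 : ℝ) ^ B * ((σ 0 q : ℝ) ^ 3 / q) * (x / Real.log x ^ B) := by
        field_simp

/-- **The main term of Theorem 1.2 for `f = μ`, `a = 1` is negligible**
([cite: DrappeauTopacogullari2019, §1.1 p. 5] "if `z` is a non-positive integer, all the coefficients
`λ_{h,ℓ}(z)` vanish"; here `z = −1`): for every `N` there is `C` with
`‖M_μ(x; h, 1)‖ ≤ C x/(log x)^N` for all `x ≥ 2` and `h ≠ 0` with `|h| ≤ x^{1/2}`.  PROVED from the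
Siegel–Walfisz theorem for `μ` (the source evaluates `M_{d_z}` by the Selberg–Delange method; at
`z = −1` only this upper bound survives). -/
theorem norm_mainTermOne_moebius_le (N : ℕ) :
    ∃ C : ℝ, 0 ≤ C ∧ ∀ x : ℝ, 2 ≤ x → ∀ h : ℤ, h ≠ 0 → (|h| : ℝ) ≤ x ^ (1 / 2 : ℝ) →
      ‖mainTermOne ((μ : ArithmeticFunction ℤ) : ArithmeticFunction ℂ) x h 1‖ ≤
        C * x / Real.log x ^ N := by
  set B : ℝ := (N : ℝ) + 16 with hBdef
  have hB : 0 ≤ B := by positivity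
  obtain ⟨C₁, hC₁0, hC₁⟩ := abs_sum_moebius_coprime_le_of_le hB
  obtain ⟨C₃, hC₃0, hC₃⟩ := exists_sum_sigma_zero_pow_div_le_real 3
  refine ⟨2 * (2 * C₁ * (2 : ℝ) ^ B) * C₃, by positivity, fun x hx h hh hhx => ?_⟩
  have hx0 : 0 < x := by linarith
  have hx1 : 1 ≤ x := by linarith
  have hlogx : 0 < Real.log x := Real.log_pos (by linarith)
  set H := h.natAbs with hHdef
  have hH : 1 ≤ H := Int.natAbs_pos.2 hh
  have hHx : (H : ℝ) ≤ x ^ (1 / 2 : ℝ) := by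
    have : (H : ℝ) = |(h : ℝ)| := by rw [hHdef, Nat.cast_natAbs, Int.cast_abs]
    rw [this]; exact hhx
  set K : ℝ := 2 * C₁ * (2 : ℝ) ^ B with hKdef
  have hK0 : 0 ≤ K := by positivity
  -- termwise bound
  have hterm : ∀ q ∈ Icc 1 ⌊Real.sqrt x⌋₊,
      ‖((Nat.totient (q / Nat.gcd H q) : ℂ))⁻¹ *
          ∑ n ∈ (Icc 1 ⌊x⌋₊).filter (fun n : ℕ => q ^ 2 ≤ n ∧ Nat.gcd n q = Nat.gcd H q),
            ((μ : ArithmeticFunction ℤ) : ArithmeticFunction ℂ) n‖ ≤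
        K * ((σ 0 q : ℝ) ^ 3 / q) * (x / Real.log x ^ B) := by
    intro q hq
    rw [Finset.mem_Icc] at hq
    rw [norm_mul, norm_inv, Complex.norm_natCast, sum_moebius_complex_eq, Complex.norm_real,
      Real.norm_eq_abs]
    exact totient_inv_mul_abs_inner_le hB hC₁0 hC₁ hx hH hHx hq.1
  -- the divisor sum `∑_{q ≤ √x} τ(q)³/q ≤ C₃ (log x)^16`
  have hdiv : ∑ q ∈ Icc 1 ⌊Real.sqrt x⌋₊, (σ 0 q : ℝ) ^ 3 / q ≤ C₃ * Real.log x ^ (16 : ℕ) := by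
    set x' : ℝ := max (Real.sqrt x) 2 with hx'
    have hx'2 : 2 ≤ x' := le_max_right _ _
    have hx'x : x' ≤ x := by
      refine max_le ?_ hx
      rw [Real.sqrt_le_left] <;> nlinarith
    have hsub : Icc 1 ⌊Real.sqrt x⌋₊ ⊆ Icc 1 ⌊x'⌋₊ :=
      Finset.Icc_subset_Icc_right (Nat.floor_le_floor (le_max_left _ _))
    calc ∑ q ∈ Icc 1 ⌊Real.sqrt x⌋₊, (σ 0 q : ℝ) ^ 3 / q
        ≤ ∑ q ∈ Icc 1 ⌊x'⌋₊, (σ 0 q : ℝ) ^ 3 / q :=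
          Finset.sum_le_sum_of_subset_of_nonneg hsub fun _ _ _ => by positivity
      _ ≤ C₃ * Real.log x' ^ (2 ^ (3 + 1)) := hC₃ x' hx'2
      _ ≤ C₃ * Real.log x ^ (16 : ℕ) := by
          norm_num
          have h1 : Real.log x' ≤ Real.log x := Real.log_le_log (by linarith) hx'x
          have h0 : 0 ≤ Real.log x' := Real.log_nonneg (by linarith)
          gcongr
  -- `(log x)^B = (log x)^N (log x)^16`
  have hsplit : Real.log x ^ B = Real.log x ^ N * Real.log x ^ (16 : ℕ) := by
    rw [hBdef, Real.rpow_add hlogx, Real.rpow_natCast, show (16 : ℝ) = ((16 : ℕ) : ℝ) by norm_num,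
      Real.rpow_natCast]
  have hden : 0 < Real.log x ^ B := Real.rpow_pos_of_pos hlogx B
  have hdenN : 0 < Real.log x ^ N := pow_pos hlogx N
  rw [mainTermOne_one, norm_mul, Complex.norm_ofNat]
  calc 2 * ‖∑ q ∈ Icc 1 ⌊Real.sqrt x⌋₊, ((Nat.totient (q / Nat.gcd H q) : ℂ))⁻¹ *
          ∑ n ∈ (Icc 1 ⌊x⌋₊).filter (fun n : ℕ => q ^ 2 ≤ n ∧ Nat.gcd n q = Nat.gcd H q),
            ((μ : ArithmeticFunction ℤ) : ArithmeticFunction ℂ) n‖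
      ≤ 2 * ∑ q ∈ Icc 1 ⌊Real.sqrt x⌋₊, K * ((σ 0 q : ℝ) ^ 3 / q) * (x / Real.log x ^ B) := by
        gcongr
        exact (norm_sum_le _ _).trans (Finset.sum_le_sum hterm)
    _ = 2 * K * (x / Real.log x ^ B) * ∑ q ∈ Icc 1 ⌊Real.sqrt x⌋₊, (σ 0 q : ℝ) ^ 3 / q := by
        rw [Finset.mul_sum, Finset.mul_sum]
        refine Finset.sum_congr rfl fun q _ => ?_
        ring
    _ ≤ 2 * K * (x / Real.log x ^ B) * (C₃ * Real.log x ^ (16 : ℕ)) :=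
        mul_le_mul_of_nonneg_left hdiv (by positivity)
    _ = 2 * K * C₃ * x / Real.log x ^ N := by
        rw [hsplit]
        field_simp

/-! ### Theorem 1.3 at `z = −1` from Theorem 1.2 -/

/-- The shifted sum of Theorem 1.2 at `f = μ`, `a = 1` and shift `−h` is the (real) sum of
Theorem 1.3 at `z = −1`, `∑_{|h| < n ≤ x} μ(n) τ(n + h)`, cast to `ℂ`. [folklore] -/
theorem shiftedSum_moebius_neg (x : ℝ) (h : ℤ) :
    shiftedSum ((μ : ArithmeticFunction ℤ) : ArithmeticFunction ℂ) x (-h) 1 =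
      ((∑ n ∈ (Finset.Icc 1 ⌊x⌋₊).filter (fun n : ℕ => h.natAbs < n),
        (μ n : ℝ) * (σ 0 (Int.toNat ((n : ℤ) + h)) : ℝ) : ℝ) : ℂ) := by
  unfold shiftedSum
  rw [Complex.ofReal_sum]
  refine Finset.sum_congr (Finset.filter_congr fun n _ => by simp [Int.natAbs_neg]) fun n _ => ?_
  rw [ArithmeticFunction.intCoe_apply]
  simp only [Nat.cast_one, one_mul, sub_neg_eq_add]
  push_cast
  rfl

/-- **Drappeau–Topacogullari, Theorem 1.2 (`D = 1`) implies Theorem 1.3 at `z = −1`** (tree forms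
`thm12_conductorOne`, `thm13_moebius`), following the source (§8.1, p. 24: the applications "are
essentially all immediate corollaries of Theorem 1.2, except for the fact that it remains to evaluate
the main terms"): Theorem 1.2 with `A = 1`, `N + 1`, `f = μ ∈ 𝓕₁(1)` (`moebius_mem_classF`), `a = 1`
and shift `−h` gives `|∑_{|h|<n≤x} μ(n) τ(n + h) − M_μ(x; −h, 1)| ≤ C₁ τ(1) x/(log x)^{N+1}` for
`1 ≤ |h| ≤ x^{δ₁}`, and `‖M_μ(x; −h, 1)‖ ≤ C₂ x/(log x)^N` for `|h| ≤ x^{1/2}`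
(`norm_mainTermOne_moebius_le`); take `δ = min(δ₁, 1/2)`.
[cite: DrappeauTopacogullari2019, Theorem 1.3 (z = −1) and §8.1] -/
theorem thm12_conductorOne.thm13_moebius (h12 : thm12_conductorOne) : thm13_moebius := by
  intro N
  obtain ⟨δ₁, hδ₁, C₁, hC₁⟩ := h12 1 (N + 1) le_rfl (Nat.le_add_left 1 N)
  obtain ⟨C₂, hC₂0, hC₂⟩ := norm_mainTermOne_moebius_le N
  have hlog2 : 0 < Real.log 2 := Real.log_pos (by norm_num)
  refine ⟨min δ₁ (1 / 2), lt_min hδ₁ (by norm_num), max C₁ 0 / Real.log 2 + C₂, ?_⟩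
  intro x hx h hh hhx
  have hx0 : 0 < x := by linarith
  have hx1 : 1 ≤ x := by linarith
  have hlogx : 0 < Real.log x := Real.log_pos (by linarith)
  have hlog2x : Real.log 2 ≤ Real.log x := Real.log_le_log (by norm_num) hx
  -- the two ranges for `|h|`
  have hh1 : (|h| : ℝ) ≤ x ^ δ₁ :=
    hhx.trans (Real.rpow_le_rpow_of_exponent_le hx1 (min_le_left _ _))
  have hh2 : (|h| : ℝ) ≤ x ^ (1 / 2 : ℝ) :=
    hhx.trans (Real.rpow_le_rpow_of_exponent_le hx1 (min_le_right _ _))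
  have hnh : -h ≠ 0 := neg_ne_zero.2 hh
  have habs : (|((-h : ℤ) : ℝ)| : ℝ) = |(h : ℝ)| := by rw [Int.cast_neg, abs_neg]
  -- Theorem 1.2 with `f = μ`, `a = 1`, shift `-h`
  have h1 := hC₁ _ moebius_mem_classF x hx 1 (-h) le_rfl
    (by rw [Nat.cast_one]; exact Real.one_le_rpow hx1 hδ₁.le) hnh (by rw [habs]; exact hh1)
  have hσ : (σ 0 (Nat.gcd 1 (-h).natAbs) : ℝ) = 1 := by
    rw [Nat.gcd_one_left, ArithmeticFunction.sigma_zero_apply, Nat.divisors_one, Finset.card_singleton,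
      Nat.cast_one]
  rw [hσ, mul_one, shiftedSum_moebius_neg] at h1
  -- the main term
  have h2 := hC₂ x hx (-h) hnh (by rw [habs]; exact hh2)
  set S : ℝ := ∑ n ∈ (Finset.Icc 1 ⌊x⌋₊).filter (fun n : ℕ => h.natAbs < n),
    (μ n : ℝ) * (σ 0 (Int.toNat ((n : ℤ) + h)) : ℝ) with hS
  set M : ℂ := mainTermOne ((μ : ArithmeticFunction ℤ) : ArithmeticFunction ℂ) x (-h) 1 with hM
  have hdenN : 0 < Real.log x ^ N := pow_pos hlogx N
  have hdenN1 : 0 < Real.log x ^ (N + 1) := pow_pos hlogx (N + 1)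
  -- `C₁ x/(log x)^{N+1} ≤ (max C₁ 0 / log 2) x/(log x)^N`
  have hfirst : C₁ * x / Real.log x ^ (N + 1) ≤ max C₁ 0 / Real.log 2 * x / Real.log x ^ N := by
    calc C₁ * x / Real.log x ^ (N + 1) ≤ max C₁ 0 * x / Real.log x ^ (N + 1) := by
          gcongr; exact le_max_left _ _
      _ = max C₁ 0 / Real.log x * x / Real.log x ^ N := by
          rw [pow_succ]; field_simp
      _ ≤ max C₁ 0 / Real.log 2 * x / Real.log x ^ N := by
          gcongr
  calc |S| = ‖(S : ℂ)‖ := by rw [Complex.norm_real, Real.norm_eq_abs]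
    _ = ‖((S : ℂ) - M) + M‖ := by rw [sub_add_cancel]
    _ ≤ ‖(S : ℂ) - M‖ + ‖M‖ := norm_add_le _ _
    _ ≤ C₁ * x / Real.log x ^ (N + 1) + C₂ * x / Real.log x ^ N := add_le_add h1 h2
    _ ≤ max C₁ 0 / Real.log 2 * x / Real.log x ^ N + C₂ * x / Real.log x ^ N :=
        add_le_add hfirst le_rfl
    _ = (max C₁ 0 / Real.log 2 + C₂) * x / Real.log x ^ N := by ring

end DrappeauTopacogullari2019

end Literature.NumberTheory.Sieve

end
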